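import Mathlib
import HarnessLib
import HarnessLib.Audit
import Summits.Schanuel.Statement
import Literature.ModelTheory.ExponentialFields.Languages

/-!
Route: ExceptionalLines

CLOSED (retired) 2026-08-15T14:02:59Z by planner-Schanuel-route-Schanuel-ExceptionalLines-0 — reason: not-a-thesis: assembly does not conclude the sub-problem Statement — note: route-repair (cone) verdict by planner-Schanuel-route-Schanuel-ExceptionalLines-0, confirming the operator close of 13:50:54Z (closed_as=retired) whose workitem/lifecycle status was left "open" (that stale status queued unit rrepair-Schanuel-ExceptionalLines-93cba40b). CONE: the 12 unproved cone fac. The file is kept as the record of this route; refuted decls are indexed as negative knowledge (`ledger negatives`).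

# Route ExceptionalLines — exceptional lines — LW pigeonhole transported along exp-endomorphisms; π
⊥ e^α off one real-abelian line, conjugation settles the off-axis cases now

INSTANCE route (target strictly below the summit, like StokesConstantPi/ModulusFirst): the depth-1
cross term of Schanuel at the
anchor π — PiExpIndependence: π and e^α are algebraically independent for every nonzero algebraic α
(Schanuel at (πi, α); BelowSummit
records Schanuel → PiExpIndependence → e ⊥ π). It suffices to show X = GaloisOrbitRealised ∧
RealAbelianResidue: (symmetry) every
algebraic α whose square is NOT real-abelian (α² ∉ ℚ^{ab} ∩ ℝ) is moved off {α, −α} by some ring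
endomorphism of ℂ commuting with exp —
the orbit picture Kirby–Macintyre–Onshuus prove inside Zilber's field 𝔹 — and (arithmetic residue) π
⊥ e^α on the one line-type no
symmetry of ℂ_exp can move, α² ∈ ℚ^{ab} ∩ ℝ (α = 1 is e ⊥ π). The hinge is unconditional:
EndomorphismCriterion (Lindemann–Weierstrass
pigeonhole — the exceptional exponents of an anchor span at most one ℚ-line — transported along the
endomorphism), whose instance
j = conj is the theorem ConjugationOffAxes (π ⊥ e^{a+bi} for ab ≠ 0, provable now). Realises card
exceptional-lines-conjugation-galois
(F1 = ExceptionalLineDichotomy, F2 = ConjugationOffAxes, F3 = DefinabilityBridge over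
KMOTwoExistential, C1/C2 = the symmetry cruxes).
Lean: `(∀ α : ℂ, IsAlgebraic ℚ α → ¬ ((α ^ 2).im = 0 ∧ ∃ n : ℕ, 0 < n ∧ α ^ 2 ∈
IntermediateField.adjoin ℚ ({Complex.exp (2 * Real.pi * Complex.I / n)} : Set ℂ)) → ∃ j : ℂ →+* ℂ,
(∀ z : ℂ, j (Complex.exp z) = Complex.exp (j z)) ∧ j α ≠ α ∧ j α ≠ -α) ∧ (∀ α : ℂ, IsAlgebraic ℚ α →
α ≠ 0 → ((α ^ 2).im = 0 ∧ ∃ n : ℕ, 0 < n ∧ α ^ 2 ∈ IntermediateField.adjoin ℚ ({Complex.exp (2 *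
Real.pi * Complex.I / n)} : Set ℂ)) → AlgebraicIndependent ℚ ![(Real.pi : ℂ), Complex.exp α])`

## Assembly
Pure logic, kernel-checked in the planner sketch (`assembly_proof`, axioms propext /
Classical.choice / Quot.sound): given a nonzero
algebraic α, if α² is real-abelian apply RealAbelianResidue; otherwise GaloisOrbitRealised supplies
an exponential-ring endomorphism j
with jα ∉ {±α} and EndomorphismCriterion concludes. The conclusion is the route TARGET
PiExpIndependence, an instance family strictly
below the summit (BelowSummit: Schanuel → PiExpIndependence → ExpOnePiAlgebraicIndependent, both
provable now); ExoticEndomorphism and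
KMOTwoExistential are rungs/alternatives that do not enter the assembly (LadderBookkeeping,
DefinabilityBridge say how they relate).

Rationale: WHY THIS LINE. Mechanism (card exceptional-lines-conjugation-galois = Diaz2009's
(doi:10.5802/jtnb.459) conjugation device run with Lindemann–Weierstrass instead of
Gel'fond–Schneider, joined to KirbyMacintyreOnshuus2012 = arXiv:1101.4224): for a transcendental
anchor η the algebraic α with e^α
algebraic over ℚ(η) span at most ONE ℚ-line, since two ℚ-independent ones would put two
algebraically independent exponentials (tree
theorem `Literature.NumberTheory.Transcendental.algebraicIndependent_exp_holds`) inside a field of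
transcendence degree 1; a ring
endomorphism j of ℂ commuting with exp sends π to an odd multiple of π and an exceptional α to an
exceptional conjugate jα, hence
jα = ±α — so ONE endomorphism moving α off {±α} proves π ⊥ e^α (EndomorphismCriterion), and j = conj
already proves π ⊥ e^{a+bi},
ab ≠ 0 (ConjugationOffAxes; Diaz2009 Thm 5 / Prop. 1 / Thm 6 have the device with transcendence-only
outputs). Imported from model
theory: KMO's orbit analysis of Zilber's field (arXiv:1101.4224 Thm 2, §3.5 Prop., §3.7–3.8: Aut(𝔹)
acts on ℚ̄ as
{σ : σ|ℚ^{ab} ∈ {1, σ₀}}, fixed field ℚ^{ab} ∩ ℝ), which under Zilber's conjecture ℂ_exp ≅ 𝔹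
(Zilber2005PseudoExp; BaysKirby2018ANT
Thm 1.4) makes GaloisOrbitRealised true and pins the residual exceptional line to α² ∈ ℚ^{ab} ∩ ℝ —
exactly the classical hard cases
α = 1, √d, i√d (e ⊥ π "unknown": BaysKirby2018ANT §1). What it does that prior routes do not: route
RigidCore runs
'symmetry ⇒ transcendence' in the LOG sector over acl(∅) with Baker hinges; here the
Lindemann–Weierstrass sector, where the pigeonhole
is free, the hinge is PROVED in the tree, unconditional instances drop out now, and KMO's proposed
'Theorem 2 for ℂ_exp'
(KMOTwoExistential) gets an explicit transcendence price tag (DefinabilityBridge: it implies π ⊥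
e^{∛2}). Considered and not used at
open: E-function anchors (card F4, Siegel–Shidlovskii) and trdeg-2 anchors (Nesterenko1996) — layer
2; probabilistic or physical
analogies — none with a dictionary.

RANKED CRUXES. #0 PiExpIndependence (target) — π is algebraically independent of e^α for every
nonzero algebraic α — Schanuel at (πi, α); the card's exceptional line S_{ℚ(π)} is {0}. PROVED off
the axes by ConjugationOffAxes; open for every α ∈ ℝ ∪ iℝ; by ExceptionalLineDichotomy at most one
ℚ-line of α can fail. (why it might fail: Contains e ⊥ π (α = 1) and π ⊥ e^i, open with no evidence
beyond Schanuel; false iff P(π, e^α) = 0 for some algebraic α ∈ ℝ ∪ iℝ, P ∈ ℤ[x,y]∖0.)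
[Waldschmidt2000, MarquesSondow2010, BaysKirby2018ANT, doi:10.5802/jtnb.459]
#2 RealAbelianResidue (crux) — π ⊥ e^α for every nonzero algebraic α whose square is real-abelian
(α² ∈ ℚ^{ab} ∩ ℝ, i.e. α = ±√c with c ∈ ℚ(ζ_n) ∩ ℝ): the residual exceptional line-type that no
exponential-ring endomorphism of ℂ can move (every one maps 2πi to ±2πi, acts on roots of unity by ζ
↦ ζ^{±1}, so fixes ℚ^{ab} ∩ ℝ pointwise and jα = ±α exactly when α² ∈ ℚ^{ab} ∩ ℝ); it contains α = 1
(e ⊥ π), √2, i, i√3, 2cos(2π/7). By ExceptionalLineDichotomy at most ONE ℚ-line inside it fails.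
Card: 'the irreducible arithmetic core'. [difficulty: open-problem] (why it might fail: Contains e ⊥
π ('unknown', BaysKirby2018ANT §1) and π ⊥ e^i; every symmetry of ℂ_exp fixes α², so only arithmetic
input can decide it and no method separates π from a single e^α today; false iff some P(π, e^{√c}) =
0.) [BaysKirby2018ANT, Waldschmidt2000, arXiv:1101.4224, MarquesSondow2010]
#3 GaloisOrbitRealised (crux) — for every algebraic α with α² ∉ ℚ^{ab} ∩ ℝ there is a ring
endomorphism j of ℂ commuting with exp and moving α off {α, −α} (card C1/C2 in endomorphism form).
For α ∉ ℝ ∪ iℝ, j = conj works (theorem); the content is α ∈ ℝ ∪ iℝ: ∛2, i∛2, √(2^{1/3}), … Under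
Zilber's conjecture ℂ_exp ≅ 𝔹 it holds with j an automorphism (KMO §3.5 Prop. + §3.7: Aut(𝔹)|ℚ̄ = {σ
: σ|ℚ^{ab} ∈ {1, σ₀}}, fixed field ℚ^{ab} ∩ ℝ). Not implied by Schanuel. With EndomorphismCriterion
it yields π ⊥ e^α for all these α. [difficulty: open-problem] (why it might fail: No
exponential-ring endomorphism of ℂ besides id and conj is known (Mycielski's question; KMO p.2,
§3.10); realising a prescribed Galois action needs KMO's extension property over SK, open for ℂ even
under SC; false if End(ℂ_exp) = {id, conj}.) [arXiv:1101.4224, KirbyMacintyreOnshuus2012,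
Kirby2013FPEF, Zilber2005PseudoExp, BaysKirby2018ANT, arXiv:2209.01027]
#4 ExoticEndomorphism (crux) — ℂ has a ring endomorphism commuting with exp other than the identity
and complex conjugation (equivalently: a DIScontinuous one) — the first rung under
GaloisOrbitRealised (LadderBookkeeping: take α = ∛2) and the existence half of the symmetry Zilber's
conjecture predicts (𝔹 has 2^𝔠 automorphisms). [difficulty: open-problem] (why it might fail: Open
since Mycielski (KMO p.2); ℝ is not ∃-definable in ℂ_exp (projections of analytic strata are
countable or open), so no cheap obstruction, but every known source of symmetries of ℂ_exp is ℂ_exp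
≅ 𝔹; false iff all exp-endomorphisms of ℂ are continuous.) [arXiv:1101.4224, arXiv:2209.01027,
BaysKirby2018ANT, Marker2006]
#5 KMOTwoExistential (crux) — KMO's 'Theorem 2 for ℂ_exp', existential fragment (card C2): an
algebraic number pointwise definable in (ℂ, +, ·, exp) by an EXISTENTIAL formula without parameters
is real-abelian (∈ ℚ^{ab} ∩ ℝ). KMO prove Thm 1 (all real-abelian numbers ARE pointwise definable,
in ℂ_exp too) and Thm 2 (the converse) for Zilber fields, and name 'Theorem 2 for ℂ_exp' as the step
towards Zilber's conjecture they could not make 'even assuming Schanuel's Conjecture'.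
DefinabilityBridge converts it into π ⊥ e^α for all algebraic α with α² ∉ ℚ^{ab} ∩ ℝ — an
alternative feed of the symmetric sector and the transcendence price tag explaining its resistance.
[difficulty: open-problem] (why it might fail: Via DefinabilityBridge it implies π ⊥ e^{∛2}, so it
is at least a new transcendence theorem; no non-definability technique for ℂ_exp avoiding
automorphisms exists (KMO p.2); false iff some α ∉ ℚ^{ab}∩ℝ (e.g. the real ∛2) has a parameter-free
∃-definition.) [arXiv:1101.4224, KirbyMacintyreOnshuus2012, Marker2006, Kirby2013FPEF]
#9 EndomorphismCriterion (support) — provable now (~400 lines over the tree's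
`Literature.NumberTheory.Transcendental.algebraicIndependent_exp_holds` and
`transcendental_pi_holds`): if α is algebraic and a ring endomorphism j of ℂ with j ∘ exp = exp ∘ j
has jα ∉ {α, −α}, then π and e^α are algebraically independent. Proof: j(i) = ±i and e^{j(πi)} =
j(−1) = −1 give j(π) = mπ with m odd; a relation P(π, e^α) = 0 over ℚ transports to P(mπ, e^{jα}) =
0, so e^α and e^{jα} are both algebraic over ℚ(π) (π, mπ transcendental ⇒ P(π,Y), P(mπ,Y) ≢ 0); if
(α, jα) is ℚ-free, LW makes e^α, e^{jα} algebraically independent — impossible inside trdeg 1; else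
jα = qα with q ∈ ℚ∖{0, ±1} and the jⁿα = qⁿα are infinitely many roots of the minimal polynomial of
α. Card F1+F2 one storey up; the LW-sector twin of RigidCore.EndomorphismMovingLogTwo. [difficulty:
provable-now] [BakerTNT1975, doi:10.5802/jtnb.459, arXiv:1101.4224,
Literature.NumberTheory.Transcendental.algebraicIndependent_exp_holds]
#9 ConjugationOffAxes (support) — THEOREM F2 of the card, provable now (~200 lines, LW + conj): for
a transcendental η ∈ ℝ ∪ iℝ and an algebraic α with Re α ≠ 0 and Im α ≠ 0, η and e^α are
algebraically independent (instances: π ⊥ e^{1+i}; log 2 ⊥ e^{1+i}; trdeg ℚ(e^e, e^{1+i}) = trdeg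
ℚ(e^e) + 1). Proof: P(η, e^α) = 0 conjugates to P(±η, e^{ᾱ}) = 0, so e^α, e^ᾱ are algebraic over
ℚ(η), trdeg 1, while (α, ᾱ) is ℚ-free and LW gives trdeg ℚ(e^α, e^ᾱ) = 2. Same Lean statement as
card conjugation-discount-sigma-stable-core (R1) would file — filed once here (ledger dedup). At η =
π it is EndomorphismCriterion at j = conj (LadderBookkeeping). [difficulty: provable-now]
[doi:10.5802/jtnb.459, BakerTNT1975, Waldschmidt2000,
Literature.NumberTheory.Transcendental.algebraicIndependent_exp_holds]
#9 ExceptionalLineDichotomy (support) — F1 of the card, provable now (~150 lines): for a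
transcendental anchor η and ℚ-linearly independent algebraic α, β, at least one of the pairs (η,
e^α), (η, e^β) is algebraically independent — the exceptional exponents of an anchor span at most
one ℚ-line (LW: e^α, e^β algebraically independent cannot both be algebraic over ℚ(η)). At η = π,
unconditionally: at least one of e ⊥ π, π ⊥ e^{√2}; at least one of e ⊥ π, π ⊥ e^{i}. [difficulty:
provable-now] [BakerTNT1975, doi:10.5802/jtnb.459,
Literature.NumberTheory.Transcendental.algebraicIndependent_exp_holds]
#9 DefinabilityBridge (support) — provable now (L; first-order bookkeeping over Mathlib's
`FirstOrder.Language.BoundedFormula.IsExistential` / `Formula.Realize` and the tree's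
`Language.expRing` structure on ℂ): KMOTwoExistential ⇒ π ⊥ e^α for every algebraic α with α² ∉
ℚ^{ab} ∩ ℝ. Proof (card F3): if P(π, e^{α₀}) = 0, the existential formula φ(a) := m_{α₀}(a) = 0 ∧ ∃z
∃w (E(z) + 1 = 0 ∧ w·w + 1 = 0 ∧ P(w·z, E(a)) = 0) holds of α₀ (z = πi, w = −i) and only of
conjugates β with e^β algebraic over ℚ(π) (w·z = ±(2k+1)π is transcendental), hence by
ExceptionalLineDichotomy only of β ∈ ℚα₀ ∩ {conjugates of α₀} = {±α₀} (β = qα₀ conjugate ⇒ qⁿα₀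
conjugates for all n ⇒ q = ±1); so ∃a (φ(a) ∧ x = a·a) is a parameter-free ∃-definition of α₀², and
KMOTwoExistential puts α₀² in ℚ^{ab} ∩ ℝ. [difficulty: L] [arXiv:1101.4224,
KirbyMacintyreOnshuus2012, BakerTNT1975]
#9 BelowSummit (support) — lattice position, provable now (~120 lines, pattern of
`Literature.Barriers.Schanuel.expOnePiAlgebraicIndependent_of_schanuel`): Schanuel ⇒
PiExpIndependence (Schanuel at (πi, α), a ℚ-free pair since π is transcendental; e^{πi} = −1 and i,
α are algebraic, so trdeg ℚ(π, e^α) ≥ 2) and PiExpIndependence ⇒ ExpOnePiAlgebraicIndependent (α =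
1; transfer ℝ → ℂ by `AlgebraicIndependent.of_comp` along `Complex.ofRealHom`, `Complex.ofReal_exp`,
and swap the two entries). [difficulty: provable-now] [Waldschmidt2000,
Literature.Barriers.Schanuel.expOnePiAlgebraicIndependent_of_schanuel]
#9 LadderBookkeeping (support) — provable now (M): (i) GaloisOrbitRealised ⇒ ExoticEndomorphism,
witness α = 2^{1/3}: α² = 4^{1/3} lies in no cyclotomic field (a subfield of the abelian extension
ℚ(ζ_n) is normal over ℚ, but ℚ(4^{1/3}) ⊂ ℝ misses ω·4^{1/3}), and an endomorphism moving the real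
number α off {±α} is neither id nor conj (both fix α); (ii) EndomorphismCriterion ⇒ the anchor-π
case of ConjugationOffAxes (j = conj = `starRingEnd ℂ`, `Complex.exp_conj`; conj α ≠ α iff Im α ≠ 0,
conj α ≠ −α iff Re α ≠ 0 — kernel-checked in the planner sketch). [difficulty: M] [arXiv:1101.4224,
BakerTNT1975]

TWO-LAYER PLAN. Foreseen glued splits (nothing filed now): RealAbelianResidue ⇐ RealAxisResidue →
ImaginaryAxisResidue → RealAbelianResidue (α = √c real:
π ⊥ e^{√c}; α = i√c: π ⊥ (cos √c, sin √c)); GaloisOrbitRealised ⇐ CoreOrbitRealised →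
CoreCriterionTransfer → GaloisOrbitRealised-for-the-
assembly (endomorphisms of Kirby's countable core ecl(∅) suffice for the criterion and are what
Kirby2013FPEF's machinery constructs);
KMOTwoExistential ⇐ positive-existential fragment → existential fragment. An automorphism-form
transfer ZilberConjecture → GaloisOrbitRealised
over a cite fact (KMO §3.5 Prop. + §3.8) is a support to file once the fact is in Literature.

KILL CRITERIA. A proof that every exponential-ring endomorphism of ℂ is continuous
(¬ExoticEndomorphism) refutes ExoticEndomorphism and GaloisOrbitRealised
and voids the symmetric line: pivot the assembly to DefinabilityBridge (KMOTwoExistential feeding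
the symmetric sector) if that crux survives,
else close `refuted:GaloisOrbitRealised` (Schanuel untouched). A parameter-free ∃-definition of a
non-real-abelian algebraic number refutes
KMOTwoExistential (and Zilber's conjecture): drop it, keep the endomorphism line. RealAbelianResidue
or PiExpIndependence refuted (some
P(π, e^{α}) = 0) refutes Schanuel: close everything on this summit. PiExpIndependence proved
elsewhere moots the route; e ⊥ π alone does not.

NOT DECOMPOSED YET. The countable-core versions of cruxes 3–4 (endomorphisms of ecl(∅) as an
E-field; needs the `Kirby2010_ecl_isExpSubfield` API); the
transfer ZilberConjecture → GaloisOrbitRealised (needs KMO's extension Proposition as a named fact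
and transport along ℂ ≅ 𝔹); positive-∃
vs ∃ fragments of crux 5; the axis split of the residue; the quantitative version (a measure of
algebraic independence of (π, e^α) from an
LW measure by eliminating π with a resultant, card S4 — constants for a grounder); trdeg-2 anchors
(Nesterenko1996, Chudnovsky1984: an
exceptional PLANE for ℚ(π, Γ(1/4))) and the E-function storey (card F4: J₀(n) ⊥ π for all n ≥ 1 but
at most one, via the tree's
Siegel–Shidlovskii) — all layer 2 or support, filed when a crux moves.

CHEAPEST FALSIFIER. (1) Lookup: is ConjugationOffAxes or the endomorphism criterion already in print
— Waldschmidt GL326 (Waldschmidt2000) Ex. 15.16 and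
pp. 15, 399, 614, which Diaz2009 p. 551 cites for 'conjectures with modulus or conjugation'
(Diaz2009 itself READ this session, pp. 7,
16–18: not there; GL326 not held)? A hit turns three supports into citations and the grade into
'variant'; nothing is refuted.
(2) Ten-minute paper check of the hinge: an exp-endomorphism has j(π) = mπ with m odd, not ±π — the
criterion's proof covers every odd m
(mπ transcendental), refuters please confirm. (3) For crux 5: try to write a parameter-free
∃-definition of the real ∛2 in ℂ_exp from
Laczkovich's ∃-definition of ℤ (KMO §2.2); success kills KMOTwoExistential and Zilber's conjecture
at once.

NUMBERS. Known: α ∉ ℝ ∪ iℝ algebraic ⇒ π ⊥ e^α (this route, provable now from LW); α ∈ ℝ ∪ iℝ, α ≠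
0: open for EVERY α (e ⊥ π 'unknown',
BaysKirby2018ANT §1). Exceptional ℚ-lines per transcendental anchor: ≤ 1; per anchor field of
transcendence degree t: dimension ≤ t
(LW pigeonhole). KMO (arXiv:1101.4224): real-abelian numbers pointwise definable in every E-field
with cyclic kernel (Thm 1, proved for
ℂ_exp); in 𝔹 nothing else is (Thm 2), Aut(𝔹)-orbit of an algebraic number is a singleton iff it is
real-abelian (§3.8). Known
exponential-ring endomorphisms of ℂ: 2 (id, conj). Items at open: 12 (1 target, 4 cruxes, 6 support,
1 assembly).

DEFINITION REQUESTS. `realAbelianNumbers : IntermediateField ℚ ℂ` (KMO's ℚ^{abℝ} = ℚ(all roots of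
unity) ∩ ℝ, arXiv:1101.4224 §2.1) toward
Literature/ModelTheory/ExponentialFields, to replace the inline `(·).im = 0 ∧ ∃ n, 0 < n ∧ · ∈
IntermediateField.adjoin ℚ {exp(2πi/n)}`;
cite fact wanted: KMO §3.5 Proposition + §3.8 (in a Zilber field with CCP every automorphism of a
finitely generated strong partial
E-subfield containing SK extends; an algebraic number has a singleton Aut-orbit iff it is
real-abelian).

Novelty: Searches (2026-08-15): `lit read arXiv:1101.4224` (KMO; READ pp. 2–3, 6–8: Thm 1, Thm 2, §2.1–2.4,
§3.5 Prop., §3.7–3.10);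
`lit read doi:10.5802/jtnb.459` (Diaz2009; READ pp. 7, 16–18: Thm 5 'HL from Gel'fond–Schneider up
to one exception', §5 Conj. C(|u|),
Prop. 1 via conjugation, Conj. C(u₁,u₂), Thm 6); `lit galaxy search --star all` "automorphism of the
complex exponential field" (0 rows),
"exponential field automorphism" (0), "complex exponential field" (11 rows: Pila ZP tract, van den
Dries et al. LNM 2111, Baldwin;
pdf: Edmundo–Terzo free E-subrings, D'Aquino–Macintyre–Terzo Schanuel Nullstellensatz,
D'Aquino–Fornasiero–Terzo iterated exponentials,
Mariaule p-adic — none on conjugation/LW instances or on definable algebraic numbers in ℂ_exp); `lit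
frontier Schanuel --since 2020`
(30 rows: Zilber–Pink, E- /Э-values, zeta values, Hensel minimality — nothing on symmetries of
ℂ_exp); `lit bridges Schanuel --cross any`
(30 rows, none relevant); all 15 Schanuel route files (nearest: RigidCore); `lit search` ×3 →
searchd rc 75 this session
(searched-but-not-exhaustive; the card's own searches and refuter-triage-16's reading of Diaz
stand). Nearest prior art found: Diaz2009 =
doi:10.5802/jtnb.459 (conjugation + one-exception sets, engines Gel'fond–Schneider / six
exponentials, transcendence statements only);
KirbyMacintyreOnshuus2012 = arXiv:1101.4224 Thm 2 and §3.8 (orbits of algebraic numbers under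
Aut(𝔹); 'Theorem 2 for ℂ_exp' posed,
p. 2); Kirby2013FPEF = arXiv:0912.4019 §9  [refs: 10.5802/jtnb.459`, 10.5802/jtnb.459, 1101.4224, 0912.4019, doi:10.5802/jtnb.459, KirbyMacintyreOnshuus2012]

Barriers (technique_class: conjugation-symmetry LW-pigeonhole definability): - technique_class: conjugation-symmetry LW-pigeonhole definability
- Literature.Barriers.Schanuel.AxiomsDoNotForceSchanuel: respected — no axioms-to-SP transfer; the
route derives INSTANCES of Schanuel from the existence of specific endomorphisms of the one
structure ℂ_exp plus Lindemann–Weierstrass, and isolates the part no symmetry can reach as an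
explicitly arithmetic crux (RealAbelianResidue); Bays–Kirby's SP-free quasiminimal fields are
consistent with this split (their failures sit in a definable finite-dimensional core, the analogue
of the residue).
- Literature.Barriers.Schanuel.SchanuelPropertyNotFirstOrder: no first-order axiomatisation or
transfer between models is used; KMOTwoExistential quantifies over ∃-formulas evaluated in ℂ itself,
and endomorphisms enter only through preservation of exp, of ℚ and of polynomial relations.
- Literature.Barriers.Schanuel.AlgebraicIndependenceOfLogarithms: evaded by sector — every output is
independence of an anchor from e^α with α ALGEBRAIC, where Lindemann–Weierstrass gives full
algebraic independence and the pigeonhole costs nothing; the route says nothing about two logarithms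
(there the exceptional set {β : log β ∈ ℚ(π)^alg} is a group of unbounded rank precisely because
AlgIndepLogarithms is open) — recorded as the reason the trick stops at the log sector (RigidCore's
territory).
- Literature.Barriers.Schanuel.AxSchanuelFunctionalNotNumerical: outside the class — no derivations
are used; all numbers involved (π, α, e^α) lie

Novelty grade: new-combination — ROUTE REVIEW (refuter rreview g2, 08-15). STRUCTURE: retired correctly (D-0027 §2.1): Assembly concludes PiExpIndependence, not `Schanuel` (= SchanuelConjecture, rfl-checked); no glue PiExpIndependence→Schanuel is plausible, so no conforming re-filing on this summit; salvage the provable-now support (refuter refuter-rreview-route-Schanuel-Exception-0816cb8f-g2-0, 2026-08-15T14:15:24Z; prior: doi:10.5802/jtnb.459, arXiv:1101.4224, arXiv:0912.4019)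

History (route lifecycle, newest last):
- 2026-08-15T13:50:54Z · CLOSED retired — not-a-thesis: assembly does not conclude the sub-problem Statement (operator:999:1257524)
- 2026-08-15T14:02:59Z · CLOSED retired — not-a-thesis: assembly does not conclude the sub-problem Statement (planner-Schanuel-route-Schanuel-ExceptionalLines-0)

sub-problem: Schanuel · status: closed(retired) · opened planner-plancard-Schanuel-Schanuel-exceptiona-7c4b660f-0 2026-08-15T12:19:31Z · rev 0 · ledger route-Schanuel-ExceptionalLines
GENERATED by the gate from the ledger (D-0016/17). Provers cite these decls: `theorem foo : Summit.Schanuel.Schanuel.Theses.ExceptionalLines.<Decl> := …` in Summits/Schanuel/Schanuel/Theorems/<Name>.lean.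
-/

namespace Summit.Schanuel.Schanuel.Theses.ExceptionalLines

open scoped BigOperators Topology Manifold Classical MeasureTheory ProbabilityTheory Matrix InnerProductSpace ComplexConjugate ContinuousMap
open Filter Set Function TopologicalSpace MeasureTheory

attribute [summit_statement] _root_.Schanuel

open Literature.Periods

/-- item stmt-Schanuel-7897 · target · rank 0 · closed · moot by None · by planner
why it might fail: Contains e ⊥ π (α = 1) and π ⊥ e^i, open with no evidence beyond Schanuel; false iff P(π, e^α) = 0 for some algebraic α ∈ ℝ ∪ iℝ, P ∈ ℤ[x,y]∖0.
sources: Waldschmidt2000, MarquesSondow2010, BaysKirby2018ANT, doi:10.5802/jtnb.459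
[target] π is algebraically independent of e^α for every nonzero algebraic α — Schanuel at (πi, α);
the card's exceptional line S_{ℚ(π)} is {0}. PROVED off the axes by ConjugationOffAxes; open for
every α ∈ ℝ ∪ iℝ; by ExceptionalLineDichotomy at most one ℚ-line of α can fail. -/
@[route_item "route-Schanuel-ExceptionalLines"]
def PiExpIndependence : Prop :=
  ∀ α : ℂ, IsAlgebraic ℚ α → α ≠ 0 → AlgebraicIndependent ℚ ![(Real.pi : ℂ), Complex.exp α]

/-- item stmt-Schanuel-7898 · crux · rank 2 · closed · moot by None · by planner
why it might fail: Contains e ⊥ π ('unknown', BaysKirby2018ANT §1) and π ⊥ e^i; every symmetry of ℂ_exp fixes α², so only arithmetic input can decide it and no method separates π from a single e^α today; false iff some P(π, e^{√c}) = 0.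
sources: BaysKirby2018ANT, Waldschmidt2000, arXiv:1101.4224, MarquesSondow2010
[crux] π ⊥ e^α for every nonzero algebraic α whose square is real-abelian (α² ∈ ℚ^{ab} ∩ ℝ, i.e. α =
±√c with c ∈ ℚ(ζ_n) ∩ ℝ): the residual exceptional line-type that no exponential-ring endomorphism
of ℂ can move (every one maps 2πi to ±2πi, acts on roots of unity by ζ ↦ ζ^{±1}, so fixes ℚ^{ab} ∩ ℝ
pointwise and jα = ±α exactly when α² ∈ ℚ^{ab} ∩ ℝ); it contains α = 1 (e ⊥ π), √2, i, i√3,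
2cos(2π/7). By ExceptionalLineDichotomy at most ONE ℚ-line inside it fails. Card: 'the irreducible
arithmetic core'. [difficulty: open-problem] -/
@[route_item "route-Schanuel-ExceptionalLines"]
def RealAbelianResidue : Prop :=
  ∀ α : ℂ, IsAlgebraic ℚ α → α ≠ 0 → ((α ^ 2).im = 0 ∧ ∃ n : ℕ, 0 < n ∧ α ^ 2 ∈ IntermediateField.adjoin ℚ ({Complex.exp (2 * Real.pi * Complex.I / n)} : Set ℂ)) → AlgebraicIndependent ℚ ![(Real.pi : ℂ), Complex.exp α]

/-- item stmt-Schanuel-7899 · crux · rank 3 · closed · moot by None · by planner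
why it might fail: No exponential-ring endomorphism of ℂ besides id and conj is known (Mycielski's question; KMO p.2, §3.10); realising a prescribed Galois action needs KMO's extension property over SK, open for ℂ even under SC; false if End(ℂ_exp) = {id, conj}.
sources: arXiv:1101.4224, KirbyMacintyreOnshuus2012, Kirby2013FPEF, Zilber2005PseudoExp, BaysKirby2018ANT, arXiv:2209.01027
[crux] for every algebraic α with α² ∉ ℚ^{ab} ∩ ℝ there is a ring endomorphism j of ℂ commuting with
exp and moving α off {α, −α} (card C1/C2 in endomorphism form). For α ∉ ℝ ∪ iℝ, j = conj works
(theorem); the content is α ∈ ℝ ∪ iℝ: ∛2, i∛2, √(2^{1/3}), … Under Zilber's conjecture ℂ_exp ≅ 𝔹 it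
holds with j an automorphism (KMO §3.5 Prop. + §3.7: Aut(𝔹)|ℚ̄ = {σ : σ|ℚ^{ab} ∈ {1, σ₀}}, fixed
field ℚ^{ab} ∩ ℝ). Not implied by Schanuel. With EndomorphismCriterion it yields π ⊥ e^α for all
these α. [difficulty: open-problem] -/
@[route_item "route-Schanuel-ExceptionalLines"]
def GaloisOrbitRealised : Prop :=
  ∀ α : ℂ, IsAlgebraic ℚ α → ¬ ((α ^ 2).im = 0 ∧ ∃ n : ℕ, 0 < n ∧ α ^ 2 ∈ IntermediateField.adjoin ℚ ({Complex.exp (2 * Real.pi * Complex.I / n)} : Set ℂ)) → ∃ j : ℂ →+* ℂ, (∀ z : ℂ, j (Complex.exp z) = Complex.exp (j z)) ∧ j α ≠ α ∧ j α ≠ -α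

/-- item stmt-Schanuel-7900 · crux · rank 4 · closed · moot by None · by planner
why it might fail: Open since Mycielski (KMO p.2); ℝ is not ∃-definable in ℂ_exp (projections of analytic strata are countable or open), so no cheap obstruction, but every known source of symmetries of ℂ_exp is ℂ_exp ≅ 𝔹; false iff all exp-endomorphisms of ℂ are continuous.
sources: arXiv:1101.4224, arXiv:2209.01027, BaysKirby2018ANT, Marker2006
[crux] ℂ has a ring endomorphism commuting with exp other than the identity and complex conjugation
(equivalently: a DIScontinuous one) — the first rung under GaloisOrbitRealised (LadderBookkeeping:
take α = ∛2) and the existence half of the symmetry Zilber's conjecture predicts (𝔹 has 2^𝔠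
automorphisms). [difficulty: open-problem] -/
@[route_item "route-Schanuel-ExceptionalLines"]
def ExoticEndomorphism : Prop :=
  ∃ j : ℂ →+* ℂ, (∀ z : ℂ, j (Complex.exp z) = Complex.exp (j z)) ∧ ¬ (∀ z : ℂ, j z = z) ∧ ¬ (∀ z : ℂ, j z = (starRingEnd ℂ) z)

/-- item stmt-Schanuel-7901 · crux · rank 5 · closed · moot by None · by planner
why it might fail: Via DefinabilityBridge it implies π ⊥ e^{∛2}, so it is at least a new transcendence theorem; no non-definability technique for ℂ_exp avoiding automorphisms exists (KMO p.2); false iff some α ∉ ℚ^{ab}∩ℝ (e.g. the real ∛2) has a parameter-free ∃-definition.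
sources: arXiv:1101.4224, KirbyMacintyreOnshuus2012, Marker2006, Kirby2013FPEF
[crux] KMO's 'Theorem 2 for ℂ_exp', existential fragment (card C2): an algebraic number pointwise
definable in (ℂ, +, ·, exp) by an EXISTENTIAL formula without parameters is real-abelian (∈ ℚ^{ab} ∩
ℝ). KMO prove Thm 1 (all real-abelian numbers ARE pointwise definable, in ℂ_exp too) and Thm 2 (the
converse) for Zilber fields, and name 'Theorem 2 for ℂ_exp' as the step towards Zilber's conjecture
they could not make 'even assuming Schanuel's Conjecture'. DefinabilityBridge converts it into π ⊥
e^α for all algebraic α with α² ∉ ℚ^{ab} ∩ ℝ — an alternative feed of the symmetric sector and the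
transcendence price tag explaining its resistance. [difficulty: open-problem] -/
@[route_item "route-Schanuel-ExceptionalLines"]
def KMOTwoExistential : Prop :=
  ∀ a : ℂ, IsAlgebraic ℚ a → (∃ φ : Literature.ModelTheory.ExponentialFields.Language.expRing.Formula (Fin 1), FirstOrder.Language.BoundedFormula.IsExistential φ ∧ ∀ x : ℂ, φ.Realize ![x] ↔ x = a) → (a.im = 0 ∧ ∃ n : ℕ, 0 < n ∧ a ∈ IntermediateField.adjoin ℚ ({Complex.exp (2 * Real.pi * Complex.I / n)} : Set ℂ))

/-- item stmt-Schanuel-7902 · support · rank 9 · closed · moot by None · by planner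
sources: BakerTNT1975, doi:10.5802/jtnb.459, arXiv:1101.4224, Literature.NumberTheory.Transcendental.algebraicIndependent_exp_holds
[support] provable now (~400 lines over the tree's
`Literature.NumberTheory.Transcendental.algebraicIndependent_exp_holds` and
`transcendental_pi_holds`): if α is algebraic and a ring endomorphism j of ℂ with j ∘ exp = exp ∘ j
has jα ∉ {α, −α}, then π and e^α are algebraically independent. Proof: j(i) = ±i and e^{j(πi)} =
j(−1) = −1 give j(π) = mπ with m odd; a relation P(π, e^α) = 0 over ℚ transports to P(mπ, e^{jα}) =
0, so e^α and e^{jα} are both algebraic over ℚ(π) (π, mπ transcendental ⇒ P(π,Y), P(mπ,Y) ≢ 0); if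
(α, jα) is ℚ-free, LW makes e^α, e^{jα} algebraically independent — impossible inside trdeg 1; else
jα = qα with q ∈ ℚ∖{0, ±1} and the jⁿα = qⁿα are infinitely many roots of the minimal polynomial of
α. Card F1+F2 one storey up; the LW-sector twin of RigidCore.EndomorphismMovingLogTwo. [difficulty:
provable-now] -/
@[route_item "route-Schanuel-ExceptionalLines"]
def EndomorphismCriterion : Prop :=
  ∀ α : ℂ, IsAlgebraic ℚ α → ∀ j : ℂ →+* ℂ, (∀ z : ℂ, j (Complex.exp z) = Complex.exp (j z)) → j α ≠ α → j α ≠ -α → AlgebraicIndependent ℚ ![(Real.pi : ℂ), Complex.exp α]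

/-- item stmt-Schanuel-7903 · support · rank 9 · closed · moot by None · by planner
sources: doi:10.5802/jtnb.459, BakerTNT1975, Waldschmidt2000, Literature.NumberTheory.Transcendental.algebraicIndependent_exp_holds
[support] THEOREM F2 of the card, provable now (~200 lines, LW + conj): for a transcendental η ∈ ℝ ∪
iℝ and an algebraic α with Re α ≠ 0 and Im α ≠ 0, η and e^α are algebraically independent
(instances: π ⊥ e^{1+i}; log 2 ⊥ e^{1+i}; trdeg ℚ(e^e, e^{1+i}) = trdeg ℚ(e^e) + 1). Proof: P(η,
e^α) = 0 conjugates to P(±η, e^{ᾱ}) = 0, so e^α, e^ᾱ are algebraic over ℚ(η), trdeg 1, while (α, ᾱ)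
is ℚ-free and LW gives trdeg ℚ(e^α, e^ᾱ) = 2. Same Lean statement as card
conjugation-discount-sigma-stable-core (R1) would file — filed once here (ledger dedup). At η = π it
is EndomorphismCriterion at j = conj (LadderBookkeeping). [difficulty: provable-now] -/
@[route_item "route-Schanuel-ExceptionalLines"]
def ConjugationOffAxes : Prop :=
  ∀ η α : ℂ, (η.im = 0 ∨ η.re = 0) → Transcendental ℚ η → IsAlgebraic ℚ α → α.re ≠ 0 → α.im ≠ 0 → AlgebraicIndependent ℚ ![η, Complex.exp α]

/-- item stmt-Schanuel-7904 · support · rank 9 · closed · moot by None · by planner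
sources: BakerTNT1975, doi:10.5802/jtnb.459, Literature.NumberTheory.Transcendental.algebraicIndependent_exp_holds
[support] F1 of the card, provable now (~150 lines): for a transcendental anchor η and ℚ-linearly
independent algebraic α, β, at least one of the pairs (η, e^α), (η, e^β) is algebraically
independent — the exceptional exponents of an anchor span at most one ℚ-line (LW: e^α, e^β
algebraically independent cannot both be algebraic over ℚ(η)). At η = π, unconditionally: at least
one of e ⊥ π, π ⊥ e^{√2}; at least one of e ⊥ π, π ⊥ e^{i}. [difficulty: provable-now] -/
@[route_item "route-Schanuel-ExceptionalLines"]
def ExceptionalLineDichotomy : Prop :=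
  ∀ η α β : ℂ, Transcendental ℚ η → IsAlgebraic ℚ α → IsAlgebraic ℚ β → LinearIndependent ℚ ![α, β] → AlgebraicIndependent ℚ ![η, Complex.exp α] ∨ AlgebraicIndependent ℚ ![η, Complex.exp β]

/-- item stmt-Schanuel-7905 · support · rank 9 · closed · moot by None · by planner
sources: arXiv:1101.4224, KirbyMacintyreOnshuus2012, BakerTNT1975
[support] provable now (L; first-order bookkeeping over Mathlib's
`FirstOrder.Language.BoundedFormula.IsExistential` / `Formula.Realize` and the tree's
`Language.expRing` structure on ℂ): KMOTwoExistential ⇒ π ⊥ e^α for every algebraic α with α² ∉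
ℚ^{ab} ∩ ℝ. Proof (card F3): if P(π, e^{α₀}) = 0, the existential formula φ(a) := m_{α₀}(a) = 0 ∧ ∃z
∃w (E(z) + 1 = 0 ∧ w·w + 1 = 0 ∧ P(w·z, E(a)) = 0) holds of α₀ (z = πi, w = −i) and only of
conjugates β with e^β algebraic over ℚ(π) (w·z = ±(2k+1)π is transcendental), hence by
ExceptionalLineDichotomy only of β ∈ ℚα₀ ∩ {conjugates of α₀} = {±α₀} (β = qα₀ conjugate ⇒ qⁿα₀
conjugates for all n ⇒ q = ±1); so ∃a (φ(a) ∧ x = a·a) is a parameter-free ∃-definition of α₀², and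
KMOTwoExistential puts α₀² in ℚ^{ab} ∩ ℝ. [difficulty: L] -/
@[route_item "route-Schanuel-ExceptionalLines"]
def DefinabilityBridge : Prop :=
  KMOTwoExistential → ∀ α : ℂ, IsAlgebraic ℚ α → ¬ ((α ^ 2).im = 0 ∧ ∃ n : ℕ, 0 < n ∧ α ^ 2 ∈ IntermediateField.adjoin ℚ ({Complex.exp (2 * Real.pi * Complex.I / n)} : Set ℂ)) → AlgebraicIndependent ℚ ![(Real.pi : ℂ), Complex.exp α]

/-- item stmt-Schanuel-7906 · support · rank 9 · closed · moot by None · by planner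
sources: Waldschmidt2000, Literature.Barriers.Schanuel.expOnePiAlgebraicIndependent_of_schanuel
[support] lattice position, provable now (~120 lines, pattern of
`Literature.Barriers.Schanuel.expOnePiAlgebraicIndependent_of_schanuel`): Schanuel ⇒
PiExpIndependence (Schanuel at (πi, α), a ℚ-free pair since π is transcendental; e^{πi} = −1 and i,
α are algebraic, so trdeg ℚ(π, e^α) ≥ 2) and PiExpIndependence ⇒ ExpOnePiAlgebraicIndependent (α =
1; transfer ℝ → ℂ by `AlgebraicIndependent.of_comp` along `Complex.ofRealHom`, `Complex.ofReal_exp`,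
and swap the two entries). [difficulty: provable-now] -/
@[route_item "route-Schanuel-ExceptionalLines"]
def BelowSummit : Prop :=
  (Schanuel → PiExpIndependence) ∧ (PiExpIndependence → Literature.NumberTheory.Transcendental.ExpOnePiAlgebraicIndependent)

/-- item stmt-Schanuel-7907 · support · rank 9 · closed · moot by None · by planner
sources: arXiv:1101.4224, BakerTNT1975
[support] provable now (M): (i) GaloisOrbitRealised ⇒ ExoticEndomorphism, witness α = 2^{1/3}: α² =
4^{1/3} lies in no cyclotomic field (a subfield of the abelian extension ℚ(ζ_n) is normal over ℚ,
but ℚ(4^{1/3}) ⊂ ℝ misses ω·4^{1/3}), and an endomorphism moving the real number α off {±α} is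
neither id nor conj (both fix α); (ii) EndomorphismCriterion ⇒ the anchor-π case of
ConjugationOffAxes (j = conj = `starRingEnd ℂ`, `Complex.exp_conj`; conj α ≠ α iff Im α ≠ 0, conj α
≠ −α iff Re α ≠ 0 — kernel-checked in the planner sketch). [difficulty: M] -/
@[route_item "route-Schanuel-ExceptionalLines"]
def LadderBookkeeping : Prop :=
  (GaloisOrbitRealised → ExoticEndomorphism) ∧ (EndomorphismCriterion → ∀ α : ℂ, IsAlgebraic ℚ α → α.re ≠ 0 → α.im ≠ 0 → AlgebraicIndependent ℚ ![(Real.pi : ℂ), Complex.exp α])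

/-- item stmt-Schanuel-7908 · assembly · rank 1 · closed · moot by None · by planner
sources: arXiv:1101.4224, doi:10.5802/jtnb.459
[assembly] EndomorphismCriterion → GaloisOrbitRealised → RealAbelianResidue → PiExpIndependence. -/
@[route_item "route-Schanuel-ExceptionalLines"]
def Assembly : Prop :=
  EndomorphismCriterion → GaloisOrbitRealised → RealAbelianResidue → PiExpIndependence

end Summit.Schanuel.Schanuel.Theses.ExceptionalLines
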